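import Literature.NumberTheory.Automorphic.IdeleNormUnfolding
import Literature.NumberTheory.Automorphic.QuadraticIdelicNormRange
import Literature.NumberTheory.Automorphic.QuadraticHeckeCharacter
import HarnessLib

/-!
# Idele-norm unfolding for a quadratic extension: the two class-field-theory inputs discharged
(O'Meara, *Introduction to Quadratic Forms* (1963), §65A Example 65:2 and §65D Thm. 65:23 (Hasse's norm theorem);
Rogawski, *Automorphic Representations of Unitary Groups in Three Variables* (1990), §7.2 p. 94)

Topic `NumberTheory/Automorphic`; namespace `Literature.NumberTheory.Automorphic`. THEOREMS ONLY over accepted tree modules: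
no definition, no named fact, no instance, no notation, no `sorry`. Row (C-torus) FILE 3c of the T1-qs LAW 5 road of
`Cruxes/H413/Lines/F0_T1InnerFormTraceIdentity.lean` (cell `pub/hodgecm-mathlib`, crux H413): for a QUADRATIC extension
`E = F(δ)`, `δ² = θ ∈ 𝓞 F ∖ 0`, `σ δ = -δ`, the hypotheses `hH` (openness of `Fˣ · N(𝕀_E)`) and `hHasse` of
★ `IdeleNormUnfolding.exists_lintegral_comp_ideleRelNorm_mul_weight_eq_setLIntegral` hold:

* `exists_principalIdeles_ideleRelNorm_eq` — **Hasse's norm theorem for principal ideles**: a principal idele `(t)` of `F`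
  that is the norm of an idele of `E` is the norm of the principal idele `(x + yδ)`, `x² − θ y² = t`
  (★ `principal_mem_range_ideleRelNorm_iff_exists`, O'Meara 65:23, and `(x + yδ) σ(x + yδ) = x² − θ y²`).
* `isOpen_principalIdeles_sup_range_ideleRelNorm` — `Fˣ · N(𝕀_E) = principalIdeles F ⊔ normIdeles F θ` is open
  (★ `range_ideleRelNorm_eq_normIdeles`, ★ `isOpen_principalIdeles_sup_normIdeles`).
* **`exists_lintegral_comp_ideleRelNorm_mul_weight_eq_setLIntegral_inter_normIdeles`** and
  **`exists_setLIntegral_comp_ideleRelNorm_eq_setLIntegral_inter_normIdeles`** — the rows of ★ `IdeleNormUnfolding` with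
  right side `K * ∫⁻ y in 𝓕 ∩ ↑(principalIdeles F ⊔ normIdeles F θ), g y ∂μF`, unconditionally.

## References

* O. T. O'Meara, *Introduction to Quadratic Forms* (1963), §65A Example 65:2, §65D Thm. 65:23 [Omeara1963].
* J. D. Rogawski, *Automorphic Representations of Unitary Groups in Three Variables* (1990), §7.2 (p. 94) [Rogawski1990].
* J. W. S. Cassels, A. Fröhlich (eds.), *Algebraic Number Theory* (1967), Ch. VII §2, §6 [CasselsFrohlichANT1967].
-/

set_option autoImplicit false

noncomputable section

open MeasureTheory Measure NumberField IsDedekindDomain Set Literature.MeasureTheory.Group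
open Literature.NumberTheory.QuadraticForms (normIdeles)
open scoped ENNReal NNReal

namespace Literature.NumberTheory.Automorphic

variable {F E : Type} [Field F] [NumberField F] [Field E] [NumberField E] [Algebra F E]
  [Algebra.IsQuadraticExtension F E]

/-- **Hasse's norm theorem for principal ideles of a quadratic extension.** For `E = F(δ)`, `σ δ = -δ ≠ 0`, `δ² = d`:
a principal idele `(t)` of `F` lying in `N_{E/F}(𝕀_E)` is the norm of a PRINCIPAL idele of `E`, namely of `(x + y δ)` with
`x² − d y² = t` (★ `principal_mem_range_ideleRelNorm_iff_exists`; then `(N(ℓ))_E = ℓ · σ ℓ = (x² − d y²)_E = (t)_E`,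
★ `ideleGalNorm_eq_mul_smul_of_apply_eq_neg`, ★ `AdeleRing.ideleRelNorm_eq_iff`).
[cite: Omeara1963, §65D Thm. 65:23 and §65A Example 65:2] -/
theorem exists_principalIdeles_ideleRelNorm_eq (σ : E ≃ₐ[F] E) {δ : E} (hσδ : σ δ = -δ) (hδ : δ ≠ 0) {d : F}
    (hd : δ * δ = algebraMap F E d) {k : (AdeleRing (𝓞 F) F)ˣ} (hkP : k ∈ GaloisRepresentations.principalIdeles F)
    (hkN : k ∈ (AdeleRing.ideleRelNorm F E).range) :
    ∃ e ∈ GaloisRepresentations.principalIdeles E, AdeleRing.ideleRelNorm F E e = k := by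
  obtain ⟨t, rfl⟩ := hkP
  obtain ⟨x, y, hxy⟩ := (principal_mem_range_ideleRelNorm_iff_exists σ hσδ hδ hd t).1 hkN
  -- the global element `ℓ = x + y δ` with `ℓ · σ ℓ = x² − d y² = t`
  set ℓ : E := algebraMap F E x + algebraMap F E y * δ with hℓ
  have hσℓ : σ ℓ = algebraMap F E x - algebraMap F E y * δ := by
    rw [hℓ, map_add, map_mul, AlgEquiv.commutes, AlgEquiv.commutes, hσδ, mul_neg, sub_eq_add_neg]
  have hnorm : ℓ * σ ℓ = algebraMap F E (t : F) := by
    calc ℓ * σ ℓ = algebraMap F E x ^ 2 - algebraMap F E y ^ 2 * (δ * δ) := by rw [hσℓ, hℓ]; ring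
      _ = algebraMap F E (x ^ 2 - d * y ^ 2) := by rw [hd, map_sub, map_pow, map_mul, map_pow]; ring
      _ = algebraMap F E (t : F) := by rw [hxy]
  have hℓ0 : ℓ ≠ 0 := by
    intro h0
    rw [h0, zero_mul, eq_comm, map_eq_zero_iff _ (algebraMap F E).injective] at hnorm
    exact t.ne_zero hnorm
  refine ⟨Units.map (algebraMap E (AdeleRing (𝓞 E) E) : E →* AdeleRing (𝓞 E) E) (Units.mk0 ℓ hℓ0),
    ⟨Units.mk0 ℓ hℓ0, rfl⟩, AdeleRing.ideleRelNorm_eq_iff.2 (Units.ext ?_)⟩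
  rw [AdeleRing.coe_ideleBaseChange, ideleGalNorm_eq_mul_smul_of_apply_eq_neg σ hσδ hδ, Units.val_mul,
    AdeleRing.coe_smul_units]
  show AdeleRing.baseChange F E (algebraMap F (AdeleRing (𝓞 F) F) (t : F)) =
    algebraMap E (AdeleRing (𝓞 E) E) ℓ * σ • algebraMap E (AdeleRing (𝓞 E) E) ℓ
  rw [AdeleRing.smul_algebraMap, ← map_mul, hnorm, AdeleRing.baseChange_algebraMap]

/-- **`Fˣ · N_{E/F}(𝕀_E)` is open** for `E = F(δ)`, `δ² = θ ∈ 𝓞 F ∖ 0`: it is `principalIdeles F ⊔ normIdeles F θ`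
(★ `range_ideleRelNorm_eq_normIdeles`), open by ★ `isOpen_principalIdeles_sup_normIdeles`.
[cite: Omeara1963, §65A Example 65:2] -/
theorem isOpen_principalIdeles_sup_range_ideleRelNorm (σ : E ≃ₐ[F] E) {δ : E} (hσδ : σ δ = -δ) (hδ : δ ≠ 0)
    (θ : 𝓞 F) (hθ : θ ≠ 0) (hd : δ * δ = algebraMap F E (θ : F)) :
    IsOpen ((GaloisRepresentations.principalIdeles F ⊔ (AdeleRing.ideleRelNorm F E).range :
      Subgroup (AdeleRing (𝓞 F) F)ˣ) : Set (AdeleRing (𝓞 F) F)ˣ) := by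
  rw [range_ideleRelNorm_eq_normIdeles σ hσδ hδ hd]
  exact isOpen_principalIdeles_sup_normIdeles F θ hθ

variable [MeasurableSpace (AdeleRing (𝓞 E) E)ˣ] [BorelSpace (AdeleRing (𝓞 E) E)ˣ]
  [MeasurableSpace (AdeleRing (𝓞 F) F)ˣ] [BorelSpace (AdeleRing (𝓞 F) F)ˣ]

/-- **IDELE-NORM UNFOLDING, QUADRATIC CASE (covering-weight form).** For `E = F(δ)` (`σ δ = -δ ≠ 0`, `δ² = θ ∈ 𝓞 F ∖ 0`) and
Haar measures `μE`, `μF`: `∃ K ∈ (0, ∞)`, for every `Eˣ`-covering weight `wE`, every `F`-idele class domain `𝓕` and every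
Borel `Fˣ`-invariant `g ≥ 0` on `𝕀_F`:
**`∫⁻ x, g (N x) * wE x ∂μE = K * ∫⁻ y in 𝓕 ∩ ↑(principalIdeles F ⊔ normIdeles F θ), g y ∂μF`** — Rogawski's
`∫_{𝐙M∖𝐌} = m(𝐙S∖𝐒) ∫_{NE^*∖NI_E}` on the `F`-idele side, over the norm classes (index two). [cite: Rogawski1990, §7.2 (p. 94)]
[cite: Omeara1963, §65A Example 65:2] -/
theorem exists_lintegral_comp_ideleRelNorm_mul_weight_eq_setLIntegral_inter_normIdeles (σ : E ≃ₐ[F] E) {δ : E}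
    (hσδ : σ δ = -δ) (hδ : δ ≠ 0) (θ : 𝓞 F) (hθ : θ ≠ 0) (hd : δ * δ = algebraMap F E (θ : F))
    (μE : Measure (AdeleRing (𝓞 E) E)ˣ) [IsHaarMeasure μE] (μF : Measure (AdeleRing (𝓞 F) F)ˣ) [IsHaarMeasure μF] :
    ∃ K : ℝ≥0∞, K ≠ 0 ∧ K ≠ ∞ ∧
      ∀ wE : (AdeleRing (𝓞 E) E)ˣ → ℝ≥0∞, IsCoveringWeight (GaloisRepresentations.principalIdeles E) wE →
      ∀ 𝓕 : Set (AdeleRing (𝓞 F) F)ˣ, IsIdeleClassDomain F 𝓕 →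
      ∀ g : (AdeleRing (𝓞 F) F)ˣ → ℝ≥0∞, Measurable g →
        (∀ k ∈ GaloisRepresentations.principalIdeles F, ∀ y, g (k * y) = g y) →
        ∫⁻ x, g (AdeleRing.ideleRelNorm F E x) * wE x ∂μE =
          K * ∫⁻ y in 𝓕 ∩ ↑(GaloisRepresentations.principalIdeles F ⊔ normIdeles F (θ : F)), g y ∂μF := by
  obtain ⟨K, hK0, hKt, hK⟩ := exists_lintegral_comp_ideleRelNorm_mul_weight_eq_setLIntegral (F := F) (E := E) μE μF
    (isOpen_principalIdeles_sup_range_ideleRelNorm σ hσδ hδ θ hθ hd)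
    (fun _ hkP hkN => exists_principalIdeles_ideleRelNorm_eq σ hσδ hδ hd hkP hkN)
  refine ⟨K, hK0, hKt, fun wE hwE 𝓕 h𝓕 g hg hginv => ?_⟩
  rw [← range_ideleRelNorm_eq_normIdeles σ hσδ hδ hd]
  exact hK wE hwE 𝓕 h𝓕 g hg hginv

/-- **IDELE-NORM UNFOLDING, QUADRATIC CASE (idele class domains on both sides).** Same setting:
**`∫⁻ x in 𝓕E, g (N x) ∂μE = K * ∫⁻ y in 𝓕 ∩ ↑(principalIdeles F ⊔ normIdeles F θ), g y ∂μF`** for idele class domains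
`𝓕E` of `E`, `𝓕` of `F` and Borel `Fˣ`-invariant `g ≥ 0` — the `s ∩ H` of ★ `setIntegral_inter_eq_half_add_half_mul`.
[cite: Rogawski1990, §7.2 (p. 94)] [cite: Omeara1963, §65A Example 65:2] -/
theorem exists_setLIntegral_comp_ideleRelNorm_eq_setLIntegral_inter_normIdeles (σ : E ≃ₐ[F] E) {δ : E}
    (hσδ : σ δ = -δ) (hδ : δ ≠ 0) (θ : 𝓞 F) (hθ : θ ≠ 0) (hd : δ * δ = algebraMap F E (θ : F))
    (μE : Measure (AdeleRing (𝓞 E) E)ˣ) [IsHaarMeasure μE] (μF : Measure (AdeleRing (𝓞 F) F)ˣ) [IsHaarMeasure μF] :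
    ∃ K : ℝ≥0∞, K ≠ 0 ∧ K ≠ ∞ ∧
      ∀ 𝓕E : Set (AdeleRing (𝓞 E) E)ˣ, IsIdeleClassDomain E 𝓕E →
      ∀ 𝓕 : Set (AdeleRing (𝓞 F) F)ˣ, IsIdeleClassDomain F 𝓕 →
      ∀ g : (AdeleRing (𝓞 F) F)ˣ → ℝ≥0∞, Measurable g →
        (∀ k ∈ GaloisRepresentations.principalIdeles F, ∀ y, g (k * y) = g y) →
        ∫⁻ x in 𝓕E, g (AdeleRing.ideleRelNorm F E x) ∂μE =
          K * ∫⁻ y in 𝓕 ∩ ↑(GaloisRepresentations.principalIdeles F ⊔ normIdeles F (θ : F)), g y ∂μF := by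
  obtain ⟨K, hK0, hKt, hK⟩ := exists_setLIntegral_comp_ideleRelNorm_eq_setLIntegral (F := F) (E := E) μE μF
    (isOpen_principalIdeles_sup_range_ideleRelNorm σ hσδ hδ θ hθ hd)
    (fun _ hkP hkN => exists_principalIdeles_ideleRelNorm_eq σ hσδ hδ hd hkP hkN)
  refine ⟨K, hK0, hKt, fun 𝓕E h𝓕E 𝓕 h𝓕 g hg hginv => ?_⟩
  rw [← range_ideleRelNorm_eq_normIdeles σ hσδ hδ hd]
  exact hK 𝓕E h𝓕E 𝓕 h𝓕 g hg hginv

end Literature.NumberTheory.Automorphic
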